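import Literature.Probability.Percolation.LonePortSumGeneral
import Literature.Probability.Percolation.MooreShannonInfluenceBoundGeneral
import Summits.CriticalPhenomena.PercolationContinuityZ3.Theorems.PercNearOneGluingNoHeavyLowerTailThreePointIsoSexticOnePair
import Summits.CriticalPhenomena.PercolationContinuityZ3.Theorems.PercNearOneGluingNoHeavyLowerTailThreePointIsoSexticOneBond
import Summits.CriticalPhenomena.PercolationContinuityZ3.Theorems.PercNearOneGluingNoHeavyLowerTailThreePointIsoSexticSureComponent
import Summits.CriticalPhenomena.PercolationContinuityZ3.Theorems.PercNearOneGluingNoHeavyLowerTailThreePointIsoSexticFace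
import HarnessLib

/-!
# The sextic isolation law `(Q6)` and the face inequality `(C½)` hold on EVERY finite weighted graph

Support file for crux `stmt-CriticalPhenomena-4575` (`NoHeavyLowerTail`), seat `prim-l12-p1` gen 22 (`--supports stmt-CriticalPhenomena-4575`);
memo `run/shared/lean/prim/prim-l12/FROM-prim-l12-p1-g22-CHALF-ALL-GRAPHS.md` (§8), paper proof `prim-l12-p1/PROOF-CHALF-ALL-GRAPHS-gen22.md`.
(An independent kernel proof of the same theorem along the memo's §8, via edge contraction and a continuity argument, is prim-facecert g20's
`…ThreePointIsoSexticAllGraphs` chain; this file avoids contraction — pairs of weight one are handled by `…ThreePointIsoSexticSureComponent`.)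

Bond percolation `μ = prodBernoulli w` with ARBITRARY pair weights `w : Sym2 V → [0,1]` on a finite vertex type `V`, vertices `a, b, c` (no
distinctness needed).  Isolation coordinates: `Q = μ(a|b|c) = μ((a↔b)ᶜ ∩ (a↔c)ᶜ ∩ (b↔c)ᶜ)`, `I_c = μ((a↔c)ᶜ ∩ (b↔c)ᶜ)`, `I_b = μ((a↔b)ᶜ ∩ (b↔c)ᶜ)`,
`I_a = μ((a↔b)ᶜ ∩ (a↔c)ᶜ)`.
* `sextic_onePair_weak` — the real-variable heart in closed form: `…ThreePointIsoSexticOnePair.sextic_onePair` (convexity of `Q³/(I_aI_b)^{3/2}`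
  along one pair weight) with every strict-positivity hypothesis removed (`ε`-shift of `I_a, I_b` + the case `Q(1) = 0`).
* `isoSexticPort_oneBond` — for distinct `a, b, c`, any `x`, `e = s(c,x)`: `(Q6)_c` for `w[e↦0]` and `w[e↦1]` ⟹ `(Q6)_c` for `w`.  The four coordinates
  are affine in `w e` (tree `prodBernoulli_real_oneBond`), opening `e` acts on the events by `ThreePointIsoSexticOneBond.setOf_insert_mem_*`, and the
  TERMWISE inequalities `dI_a·Q₀ ≤ dQ_a·I_a,₀`, `dI_b·Q₀ ≤ dQ_b·I_b,₀` are van den Berg–Häggström–Kahn 2006 Thm 1.3 in the tree's corollary form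
  `Literature.Probability.Percolation.lonerAttachment_alone_le_allSep` (resting on the DISCHARGED fact `BHK2006_clusterConditionalPositiveAssociation`).
* `isoSexticPort_all` — **`Q⁶ ≤ I_c² · I_b³ · I_a³` on every finite weighted graph**, by induction on the number of pairs with weight in `(0,1)`: with
  `K` the sure component of `c` (`…SureComponent`): `a ∈ K`, `b ∈ K` or `a = b` give `Q = 0`; a fractional pair `ux`, `u ∈ K`, `x ∉ K` is handled by
  `transfer` (port `c → u`, as `μ(c↔u) = 1`) and `isoSexticPort_oneBond`; otherwise `isoSexticPort_of_closedSure`.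
* `isoSexticSystem_all` — all three components (`Q⁶·max(I) ≤ (I_aI_bI_c)³`); `faceHalf_all` — the FACE INEQUALITY `(C½)` at every terminal of every
  finite weighted graph: `q·x ≤ (t+u)(s+½)` in the cells (`x = μ(abc) = 1+2Q−I_a−I_b−I_c`, `s = I_c−Q`, `t = I_b−Q`, `u = I_a−Q`), i.e.
  `Cov(1_{c↔{a,b}}, 1_{a↔b}) ≤ ½·μ(c joins exactly one of a, b)`, i.e. `μ(a↔b ∣ c↔{a,b}) ≤ (1+2μ(a↔b))/3` — the `λ = ½` law of the line
  (lead g115 `ThreePointIsoSexticFace.face_half_of_isoSexticPort`); the tower fixed point `½` is never crossed, on any graph.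
No definitions, no sorries, standard axioms; unconditional.
-/

namespace Summit.CriticalPhenomena.PercolationContinuityZ3.Theorems.ThreePointIsoSexticUniversal

open MeasureTheory Set Filter Topology
open Literature.Probability.Percolation Literature.Probability.LatticeModels
open Summit.CriticalPhenomena.PercolationContinuityZ3.Theorems.ThreePointIsoSexticOnePair
open Summit.CriticalPhenomena.PercolationContinuityZ3.Theorems.ThreePointIsoSexticOneBond
open Summit.CriticalPhenomena.PercolationContinuityZ3.Theorems.ThreePointIsoSexticSureComponent
open scoped Classical

/-! ## The real-variable lemma in closed form -/

section Law

/-- The strict case with `I_a, I_b` shifted up by `ε > 0` (so that `sextic_onePair` applies verbatim). [this work] -/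
theorem sextic_onePair_shift {q₀ q₁ a₀ a₁ b₀ b₁ c₀ c₁ dqa dqb r ε : ℝ}
    (hq0 : 0 < q₀) (hq1 : 0 < q₁) (hdqa : 0 ≤ dqa) (hdqb : 0 ≤ dqb) (hdq : q₀ - q₁ = dqa + dqb)
    (ha1 : 0 ≤ a₁) (ha : a₁ ≤ a₀) (hb1 : 0 ≤ b₁) (hb : b₁ ≤ b₀) (hc0 : 0 ≤ c₀) (hc1 : 0 ≤ c₁)
    (ta : (a₀ - a₁) * q₀ ≤ dqa * a₀) (tb : (b₀ - b₁) * q₀ ≤ dqb * b₀)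
    (h0 : q₀ ^ 6 ≤ c₀ ^ 2 * b₀ ^ 3 * a₀ ^ 3) (h1 : q₁ ^ 6 ≤ c₁ ^ 2 * b₁ ^ 3 * a₁ ^ 3)
    (hr0 : 0 ≤ r) (hr1 : r ≤ 1) (hε : 0 < ε) :
    ((1 - r) * q₀ + r * q₁) ^ 6 ≤
      ((1 - r) * c₀ + r * c₁) ^ 2 * ((1 - r) * b₀ + r * b₁ + ε) ^ 3 * ((1 - r) * a₀ + r * a₁ + ε) ^ 3 := by
  have eq1 : q₀ - (dqa + dqb) = q₁ := by linarith
  have hXS : ∀ r' ∈ Icc (0 : ℝ) 1, (q₀ - r' * (dqa + dqb)) * ((a₀ - a₁) * (b₀ + ε - r' * (b₀ - b₁)) +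
      (b₀ - b₁) * (a₀ + ε - r' * (a₀ - a₁))) ≤ (dqa + dqb) * (a₀ + ε - r' * (a₀ - a₁)) * (b₀ + ε - r' * (b₀ - b₁)) := by
    intro r' hr'
    refine xs_of_termwise hr'.1 hr'.2 (by nlinarith [hr'.1, hr'.2]) (by nlinarith [hr'.1, hr'.2]) ?_ ?_ ?_ ?_
    · nlinarith [mul_nonneg hdqa hε.le]
    · rw [eq1]
      nlinarith [mul_nonneg (sub_nonneg.2 ha) hdqb, mul_nonneg hdqa hε.le, mul_nonneg (sub_nonneg.2 ha) hq1.le]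
    · nlinarith [mul_nonneg hdqb hε.le]
    · rw [eq1]
      nlinarith [mul_nonneg (sub_nonneg.2 hb) hdqa, mul_nonneg hdqb hε.le, mul_nonneg (sub_nonneg.2 hb) hq1.le]
  have h0' : q₀ ^ 6 ≤ (a₀ + ε) ^ 3 * (b₀ + ε) ^ 3 * c₀ ^ 2 := by
    have ha0 : 0 ≤ a₀ := ha1.trans ha
    have hb0 : 0 ≤ b₀ := hb1.trans hb
    calc q₀ ^ 6 ≤ c₀ ^ 2 * b₀ ^ 3 * a₀ ^ 3 := h0
      _ ≤ c₀ ^ 2 * (b₀ + ε) ^ 3 * (a₀ + ε) ^ 3 := by gcongr <;> linarith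
      _ = (a₀ + ε) ^ 3 * (b₀ + ε) ^ 3 * c₀ ^ 2 := by ring
  have h1' : (q₀ - (dqa + dqb)) ^ 6 ≤
      (a₀ + ε - (a₀ - a₁)) ^ 3 * (b₀ + ε - (b₀ - b₁)) ^ 3 * (c₀ - (c₀ - c₁)) ^ 2 := by
    calc (q₀ - (dqa + dqb)) ^ 6 = q₁ ^ 6 := by rw [eq1]
      _ ≤ c₁ ^ 2 * b₁ ^ 3 * a₁ ^ 3 := h1
      _ ≤ c₁ ^ 2 * (b₁ + ε) ^ 3 * (a₁ + ε) ^ 3 := by gcongr <;> linarith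
      _ = (a₀ + ε - (a₀ - a₁)) ^ 3 * (b₀ + ε - (b₀ - b₁)) ^ 3 * (c₀ - (c₀ - c₁)) ^ 2 := by ring
  have key := sextic_onePair (q₀ := q₀) (dq := dqa + dqb) (a₀ := a₀ + ε) (da := a₀ - a₁) (b₀ := b₀ + ε)
    (db := b₀ - b₁) (c₀ := c₀) (dc := c₀ - c₁) (r := r) hq0 (by rw [eq1]; exact hq1) (by linarith) (by linarith)
    (by linarith) (by linarith) hc0 (by linarith) (by linarith) hXS h0' h1' hr0 hr1
  have e1 : (1 - r) * q₀ + r * q₁ = q₀ - r * (dqa + dqb) := by linear_combination (-r) * hdq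
  calc ((1 - r) * q₀ + r * q₁) ^ 6 = (q₀ - r * (dqa + dqb)) ^ 6 := by rw [e1]
    _ ≤ (a₀ + ε - r * (a₀ - a₁)) ^ 3 * (b₀ + ε - r * (b₀ - b₁)) ^ 3 * (c₀ - r * (c₀ - c₁)) ^ 2 := key
    _ = ((1 - r) * c₀ + r * c₁) ^ 2 * ((1 - r) * b₀ + r * b₁ + ε) ^ 3 * ((1 - r) * a₀ + r * a₁ + ε) ^ 3 := by ring

/-- The degenerate endpoint `q₁ = 0 < q₀`: then `dq_a + dq_b = q₀`, `(q₀ − r dq_a)(q₀ − r dq_b) ≥ (1−r) q₀²`, the termwise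
inequalities give `q₀·I_a(r) ≥ a₀ (q₀ − r dq_a)`, `q₀·I_b(r) ≥ b₀ (q₀ − r dq_b)`, and `I_c(r) ≥ (1−r) c₀`, whence
`I_c(r)² I_b(r)³ I_a(r)³ ≥ (1−r)⁵ q₀⁶ ≥ ((1−r) q₀)⁶`. [this work] -/
theorem sextic_onePair_degenerate {q₀ a₀ a₁ b₀ b₁ c₀ c₁ dqa dqb r : ℝ}
    (hq0 : 0 < q₀) (hdqa : 0 ≤ dqa) (hdqb : 0 ≤ dqb) (hdq : q₀ = dqa + dqb)
    (ha1 : 0 ≤ a₁) (ha : a₁ ≤ a₀) (hb1 : 0 ≤ b₁) (hb : b₁ ≤ b₀) (hc0 : 0 ≤ c₀) (hc1 : 0 ≤ c₁)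
    (ta : (a₀ - a₁) * q₀ ≤ dqa * a₀) (tb : (b₀ - b₁) * q₀ ≤ dqb * b₀)
    (h0 : q₀ ^ 6 ≤ c₀ ^ 2 * b₀ ^ 3 * a₀ ^ 3) (hr0 : 0 ≤ r) (hr1 : r ≤ 1) :
    ((1 - r) * q₀) ^ 6 ≤ ((1 - r) * c₀ + r * c₁) ^ 2 * ((1 - r) * b₀ + r * b₁) ^ 3 * ((1 - r) * a₀ + r * a₁) ^ 3 := by
  have h1r : 0 ≤ 1 - r := sub_nonneg.2 hr1
  have ha0 : 0 ≤ a₀ := ha1.trans ha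
  have hb0 : 0 ≤ b₀ := hb1.trans hb
  -- the lower bounds for the three coordinates at `r`
  have hα0 : 0 ≤ q₀ - r * dqa := by nlinarith
  have hβ0 : 0 ≤ q₀ - r * dqb := by nlinarith
  have hA : a₀ * (q₀ - r * dqa) ≤ q₀ * ((1 - r) * a₀ + r * a₁) := by
    have e : q₀ * ((1 - r) * a₀ + r * a₁) - a₀ * (q₀ - r * dqa) = r * (dqa * a₀ - (a₀ - a₁) * q₀) := by ring
    have := mul_nonneg hr0 (sub_nonneg.2 ta)
    linarith
  have hB : b₀ * (q₀ - r * dqb) ≤ q₀ * ((1 - r) * b₀ + r * b₁) := by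
    have e : q₀ * ((1 - r) * b₀ + r * b₁) - b₀ * (q₀ - r * dqb) = r * (dqb * b₀ - (b₀ - b₁) * q₀) := by ring
    have := mul_nonneg hr0 (sub_nonneg.2 tb)
    linarith
  have hC : (1 - r) * c₀ ≤ (1 - r) * c₀ + r * c₁ := by nlinarith
  have hαβ : (1 - r) * q₀ ^ 2 ≤ (q₀ - r * dqa) * (q₀ - r * dqb) := by
    have e : (q₀ - r * dqa) * (q₀ - r * dqb) - (1 - r) * q₀ ^ 2 = r * q₀ * (q₀ - (dqa + dqb)) + r ^ 2 * (dqa * dqb) := by ring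
    have : r * q₀ * (q₀ - (dqa + dqb)) = 0 := by rw [← hdq, sub_self, mul_zero]
    nlinarith [mul_nonneg (sq_nonneg r) (mul_nonneg hdqa hdqb)]
  -- assemble: `q₀⁶ · RHS ≥ ((1−r)c₀)² (b₀β)³ (a₀α)³ ≥ (1−r)⁵ q₀¹² ≥ q₀⁶ · LHS`
  have hA3 : (a₀ * (q₀ - r * dqa)) ^ 3 ≤ (q₀ * ((1 - r) * a₀ + r * a₁)) ^ 3 :=
    pow_le_pow_left₀ (mul_nonneg ha0 hα0) hA 3
  have hB3 : (b₀ * (q₀ - r * dqb)) ^ 3 ≤ (q₀ * ((1 - r) * b₀ + r * b₁)) ^ 3 :=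
    pow_le_pow_left₀ (mul_nonneg hb0 hβ0) hB 3
  have hC2 : ((1 - r) * c₀) ^ 2 ≤ ((1 - r) * c₀ + r * c₁) ^ 2 := pow_le_pow_left₀ (mul_nonneg h1r hc0) hC 2
  have hαβ3 : ((1 - r) * q₀ ^ 2) ^ 3 ≤ ((q₀ - r * dqa) * (q₀ - r * dqb)) ^ 3 :=
    pow_le_pow_left₀ (mul_nonneg h1r (sq_nonneg q₀)) hαβ 3
  have hprod : ((1 - r) * c₀) ^ 2 * (b₀ * (q₀ - r * dqb)) ^ 3 * (a₀ * (q₀ - r * dqa)) ^ 3 ≤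
      ((1 - r) * c₀ + r * c₁) ^ 2 * (q₀ * ((1 - r) * b₀ + r * b₁)) ^ 3 * (q₀ * ((1 - r) * a₀ + r * a₁)) ^ 3 :=
    mul_le_mul (mul_le_mul hC2 hB3 (pow_nonneg (mul_nonneg hb0 hβ0) 3) (sq_nonneg _)) hA3
      (pow_nonneg (mul_nonneg ha0 hα0) 3) (mul_nonneg (sq_nonneg _) (pow_nonneg (mul_nonneg hq0.le (by nlinarith)) 3))
  have hlow : (1 - r) ^ 2 * q₀ ^ 6 * ((1 - r) * q₀ ^ 2) ^ 3 ≤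
      ((1 - r) * c₀) ^ 2 * (b₀ * (q₀ - r * dqb)) ^ 3 * (a₀ * (q₀ - r * dqa)) ^ 3 := by
    have e : ((1 - r) * c₀) ^ 2 * (b₀ * (q₀ - r * dqb)) ^ 3 * (a₀ * (q₀ - r * dqa)) ^ 3 =
        (1 - r) ^ 2 * (c₀ ^ 2 * b₀ ^ 3 * a₀ ^ 3) * ((q₀ - r * dqa) * (q₀ - r * dqb)) ^ 3 := by ring
    rw [e]
    exact mul_le_mul (mul_le_mul_of_nonneg_left h0 (sq_nonneg _)) hαβ3
      (pow_nonneg (mul_nonneg h1r (sq_nonneg q₀)) 3) (mul_nonneg (sq_nonneg _) (by positivity))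
  have h6 : (1 - r) ^ 6 ≤ (1 - r) ^ 5 := by
    calc (1 - r) ^ 6 = (1 - r) ^ 5 * (1 - r) := by ring
      _ ≤ (1 - r) ^ 5 * 1 := mul_le_mul_of_nonneg_left (by linarith) (pow_nonneg h1r 5)
      _ = (1 - r) ^ 5 := by ring
  have hfin : ((1 - r) * q₀) ^ 6 * q₀ ^ 6 ≤
      (((1 - r) * c₀ + r * c₁) ^ 2 * ((1 - r) * b₀ + r * b₁) ^ 3 * ((1 - r) * a₀ + r * a₁) ^ 3) * q₀ ^ 6 := by
    calc ((1 - r) * q₀) ^ 6 * q₀ ^ 6 = (1 - r) ^ 6 * q₀ ^ 12 := by ring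
      _ ≤ (1 - r) ^ 5 * q₀ ^ 12 := mul_le_mul_of_nonneg_right h6 (by positivity)
      _ = (1 - r) ^ 2 * q₀ ^ 6 * ((1 - r) * q₀ ^ 2) ^ 3 := by ring
      _ ≤ ((1 - r) * c₀ + r * c₁) ^ 2 * (q₀ * ((1 - r) * b₀ + r * b₁)) ^ 3 * (q₀ * ((1 - r) * a₀ + r * a₁)) ^ 3 :=
          hlow.trans hprod
      _ = (((1 - r) * c₀ + r * c₁) ^ 2 * ((1 - r) * b₀ + r * b₁) ^ 3 * ((1 - r) * a₀ + r * a₁) ^ 3) * q₀ ^ 6 := by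
          ring
  exact le_of_mul_le_mul_right hfin (pow_pos hq0 6)

/-- **`(Q6)_c` along one pair weight, endpoint form without positivity hypotheses.**  See the file header. [this work] -/
theorem sextic_onePair_weak {q₀ q₁ a₀ a₁ b₀ b₁ c₀ c₁ dqa dqb r : ℝ}
    (hq1 : 0 ≤ q₁) (hdqa : 0 ≤ dqa) (hdqb : 0 ≤ dqb) (hdq : q₀ - q₁ = dqa + dqb)
    (ha1 : 0 ≤ a₁) (ha : a₁ ≤ a₀) (hb1 : 0 ≤ b₁) (hb : b₁ ≤ b₀) (hc0 : 0 ≤ c₀) (hc1 : 0 ≤ c₁)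
    (ta : (a₀ - a₁) * q₀ ≤ dqa * a₀) (tb : (b₀ - b₁) * q₀ ≤ dqb * b₀)
    (h0 : q₀ ^ 6 ≤ c₀ ^ 2 * b₀ ^ 3 * a₀ ^ 3) (h1 : q₁ ^ 6 ≤ c₁ ^ 2 * b₁ ^ 3 * a₁ ^ 3)
    (hr0 : 0 ≤ r) (hr1 : r ≤ 1) :
    ((1 - r) * q₀ + r * q₁) ^ 6 ≤
      ((1 - r) * c₀ + r * c₁) ^ 2 * ((1 - r) * b₀ + r * b₁) ^ 3 * ((1 - r) * a₀ + r * a₁) ^ 3 := by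
  have h1r : 0 ≤ 1 - r := sub_nonneg.2 hr1
  have hA : 0 ≤ (1 - r) * a₀ + r * a₁ := add_nonneg (mul_nonneg h1r (ha1.trans ha)) (mul_nonneg hr0 ha1)
  have hB : 0 ≤ (1 - r) * b₀ + r * b₁ := add_nonneg (mul_nonneg h1r (hb1.trans hb)) (mul_nonneg hr0 hb1)
  have hq0 : 0 ≤ q₀ := by linarith
  rcases hq0.eq_or_lt with hq0z | hq0p
  · -- `q₀ = 0`, hence `q₁ = 0`
    have hz : (1 - r) * q₀ + r * q₁ = 0 := by
      rw [← hq0z, show q₁ = 0 by linarith]; ring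
    rw [hz, zero_pow (by norm_num)]
    exact mul_nonneg (mul_nonneg (sq_nonneg _) (pow_nonneg hB 3)) (pow_nonneg hA 3)
  rcases hq1.eq_or_lt with hq1z | hq1p
  · -- `q₁ = 0 < q₀`
    have hz : (1 - r) * q₀ + r * q₁ = (1 - r) * q₀ := by rw [← hq1z]; ring
    rw [hz]
    exact sextic_onePair_degenerate hq0p hdqa hdqb (by linarith) ha1 ha hb1 hb hc0 hc1 ta tb h0 hr0 hr1
  -- `q₁ > 0`: shift `I_a, I_b` by `ε > 0` and let `ε → 0`
  have hcont : Tendsto (fun ε : ℝ => ((1 - r) * c₀ + r * c₁) ^ 2 * ((1 - r) * b₀ + r * b₁ + ε) ^ 3 *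
      ((1 - r) * a₀ + r * a₁ + ε) ^ 3) (𝓝[>] 0)
      (𝓝 (((1 - r) * c₀ + r * c₁) ^ 2 * ((1 - r) * b₀ + r * b₁ + 0) ^ 3 * ((1 - r) * a₀ + r * a₁ + 0) ^ 3)) :=
    ((by fun_prop : Continuous fun ε : ℝ => ((1 - r) * c₀ + r * c₁) ^ 2 * ((1 - r) * b₀ + r * b₁ + ε) ^ 3 *
      ((1 - r) * a₀ + r * a₁ + ε) ^ 3).tendsto 0).mono_left nhdsWithin_le_nhds
  rw [add_zero, add_zero] at hcont
  exact ge_of_tendsto hcont (eventually_nhdsWithin_of_forall fun ε hε =>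
    sextic_onePair_shift hq0p hq1p hdqa hdqb hdq ha1 ha hb1 hb hc0 hc1 ta tb h0 h1 hr0 hr1 hε)

end Law

/-! ## The port component along one pair weight -/

section Graph

variable {V : Type*} [Fintype V] [DecidableEq V]

/-- **`(Q6)_c` along the weight of one pair at the port.**  For distinct `a, b, c`, any `x`, and `e = s(c, x)`: if the port component
`μ(a|b|c)⁶ ≤ μ(I_c)²·μ(I_b)³·μ(I_a)³` holds for the weights `w[e ↦ 0]` and `w[e ↦ 1]`, then it holds for `w`. [this work] -/
theorem isoSexticPort_oneBond (w : Sym2 V → unitInterval) {a b c : V} (x : V) (hab : a ≠ b) (hac : a ≠ c) (hbc : b ≠ c)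
    (h0 : (prodBernoulli (Function.update w s(c, x) 0)).real ((openConn a b)ᶜ ∩ (openConn a c)ᶜ ∩ (openConn b c)ᶜ) ^ 6 ≤
      (prodBernoulli (Function.update w s(c, x) 0)).real ((openConn a c)ᶜ ∩ (openConn b c)ᶜ) ^ 2 *
        (prodBernoulli (Function.update w s(c, x) 0)).real ((openConn a b)ᶜ ∩ (openConn b c)ᶜ) ^ 3 *
          (prodBernoulli (Function.update w s(c, x) 0)).real ((openConn a b)ᶜ ∩ (openConn a c)ᶜ) ^ 3)
    (h1 : (prodBernoulli (Function.update w s(c, x) 1)).real ((openConn a b)ᶜ ∩ (openConn a c)ᶜ ∩ (openConn b c)ᶜ) ^ 6 ≤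
      (prodBernoulli (Function.update w s(c, x) 1)).real ((openConn a c)ᶜ ∩ (openConn b c)ᶜ) ^ 2 *
        (prodBernoulli (Function.update w s(c, x) 1)).real ((openConn a b)ᶜ ∩ (openConn b c)ᶜ) ^ 3 *
          (prodBernoulli (Function.update w s(c, x) 1)).real ((openConn a b)ᶜ ∩ (openConn a c)ᶜ) ^ 3) :
    (prodBernoulli w).real ((openConn a b)ᶜ ∩ (openConn a c)ᶜ ∩ (openConn b c)ᶜ) ^ 6 ≤
      (prodBernoulli w).real ((openConn a c)ᶜ ∩ (openConn b c)ᶜ) ^ 2 *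
        (prodBernoulli w).real ((openConn a b)ᶜ ∩ (openConn b c)ᶜ) ^ 3 *
          (prodBernoulli w).real ((openConn a b)ᶜ ∩ (openConn a c)ᶜ) ^ 3 := by
  set e : Sym2 V := s(c, x) with he
  set μ0 := prodBernoulli (Function.update w e 0) with hμ0
  set μ1 := prodBernoulli (Function.update w e 1) with hμ1
  set Sep : Set (BondConfig V) := (openConn a b)ᶜ ∩ (openConn a c)ᶜ ∩ (openConn b c)ᶜ with hSep
  set IA : Set (BondConfig V) := (openConn a b)ᶜ ∩ (openConn a c)ᶜ with hIA
  set IB : Set (BondConfig V) := (openConn a b)ᶜ ∩ (openConn b c)ᶜ with hIB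
  set IC : Set (BondConfig V) := (openConn a c)ᶜ ∩ (openConn b c)ᶜ with hIC
  rw [prodBernoulli_real_oneBond (determinedBy_coe_univ Sep) w (Finset.mem_univ e),
    prodBernoulli_real_oneBond (determinedBy_coe_univ IC) w (Finset.mem_univ e),
    prodBernoulli_real_oneBond (determinedBy_coe_univ IB) w (Finset.mem_univ e),
    prodBernoulli_real_oneBond (determinedBy_coe_univ IA) w (Finset.mem_univ e)]
  -- the `e`-open endpoint in terms of `μ0`: `μ_{w[e↦1]}(A) = μ_{w[e↦0]}{ω : ω ∪ {e} ∈ A}`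
  have hupd : ∀ A : Set (BondConfig V), μ1.real A = μ0.real {ω | insert e ω ∈ A} := fun A => by
    rw [hμ1, hμ0, ← prodBernoulli_real_update_one_eq (determinedBy_coe_univ A) (Function.update w e 0) (Finset.mem_univ e),
      Function.update_idem]
  have q1 : μ1.real Sep = μ0.real (Sep ∩ (openConn a x)ᶜ ∩ (openConn b x)ᶜ) := by rw [hupd, hSep, setOf_insert_mem_sep]
  have a1 : μ1.real IA = μ0.real (IA ∩ (openConn a x)ᶜ) := by rw [hupd, hIA, setOf_insert_mem_isoA]
  have b1 : μ1.real IB = μ0.real (IB ∩ (openConn b x)ᶜ) := by rw [hupd, hIB, setOf_insert_mem_isoB]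
  -- splitting the `e`-closed coordinates
  have sa : μ0.real (IA ∩ openConn a x) + μ0.real (IA ∩ (openConn a x)ᶜ) = μ0.real IA := by
    rw [← sdiff_eq]; exact measureReal_inter_add_sdiff MeasurableSet.of_discrete
  have sb : μ0.real (IB ∩ openConn b x) + μ0.real (IB ∩ (openConn b x)ᶜ) = μ0.real IB := by
    rw [← sdiff_eq]; exact measureReal_inter_add_sdiff MeasurableSet.of_discrete
  have sq1 : μ0.real (Sep ∩ openConn a x) + μ0.real (Sep ∩ (openConn a x)ᶜ) = μ0.real Sep := by
    rw [← sdiff_eq]; exact measureReal_inter_add_sdiff MeasurableSet.of_discrete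
  have sq2 : μ0.real (Sep ∩ (openConn a x)ᶜ ∩ openConn b x) + μ0.real (Sep ∩ (openConn a x)ᶜ ∩ (openConn b x)ᶜ) =
      μ0.real (Sep ∩ (openConn a x)ᶜ) := by
    rw [← sdiff_eq]; exact measureReal_inter_add_sdiff MeasurableSet.of_discrete
  rw [hSep, sep_inter_compl_inter_eq, ← hSep] at sq2
  -- the termwise (BHK) inequalities at `μ0`
  have ta := lonerAttachment_alone_le_allSep (Function.update w e 0) ({a, b, c} : Finset V) a x (by simp)
  rw [setOf_alone_eq_isoA hab hac, setOf_pairwiseSep_eq hab hac hbc] at ta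
  have tb := lonerAttachment_alone_le_allSep (Function.update w e 0) ({a, b, c} : Finset V) b x (by simp)
  rw [setOf_alone_eq_isoB hab hbc, setOf_pairwiseSep_eq hab hac hbc] at tb
  change μ0.real (IA ∩ openConn a x) * μ0.real Sep ≤ μ0.real IA * μ0.real (Sep ∩ openConn a x) at ta
  change μ0.real (IB ∩ openConn b x) * μ0.real Sep ≤ μ0.real IB * μ0.real (Sep ∩ openConn b x) at tb
  have hr0 : (0 : ℝ) ≤ w e := (w e).2.1
  have hr1 : (w e : ℝ) ≤ 1 := (w e).2.2
  refine sextic_onePair_weak (dqa := μ0.real (Sep ∩ openConn a x)) (dqb := μ0.real (Sep ∩ openConn b x))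
    measureReal_nonneg measureReal_nonneg measureReal_nonneg (by linarith) measureReal_nonneg
    (by linarith [a1, sa, (measureReal_nonneg : 0 ≤ μ0.real (IA ∩ openConn a x))]) measureReal_nonneg
    (by linarith [b1, sb, (measureReal_nonneg : 0 ≤ μ0.real (IB ∩ openConn b x))]) measureReal_nonneg measureReal_nonneg
    ?_ ?_ h0 h1 hr0 hr1
  · have : μ0.real IA - μ1.real IA = μ0.real (IA ∩ openConn a x) := by linarith [sa, a1]
    rw [this]; linarith [ta]
  · have : μ0.real IB - μ1.real IB = μ0.real (IB ∩ openConn b x) := by linarith [sb, b1]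
    rw [this]; linarith [tb]


/-! ## Induction on the number of fractional pairs -/

/-- **The port component of the sextic isolation law `(Q6)` on every finite weighted graph**:
`μ(a|b|c)⁶ ≤ μ(c ↮ {a,b})² · μ(b ↮ {a,c})³ · μ(a ↮ {b,c})³` for bond percolation with arbitrary pair weights on a finite vertex type and
any three vertices `a, b, c`. [this work] -/
theorem isoSexticPort_all (w : Sym2 V → unitInterval) (a b c : V) :
    (prodBernoulli w).real ((openConn a b)ᶜ ∩ (openConn a c)ᶜ ∩ (openConn b c)ᶜ) ^ 6 ≤
      (prodBernoulli w).real ((openConn a c)ᶜ ∩ (openConn b c)ᶜ) ^ 2 *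
        (prodBernoulli w).real ((openConn a b)ᶜ ∩ (openConn b c)ᶜ) ^ 3 *
          (prodBernoulli w).real ((openConn a b)ᶜ ∩ (openConn a c)ᶜ) ^ 3 := by
  suffices H : ∀ (n : ℕ) (w : Sym2 V → unitInterval) (a b c : V),
      (Finset.univ.filter fun f : Sym2 V => (0 : ℝ) < w f ∧ (w f : ℝ) < 1).card = n →
      (prodBernoulli w).real ((openConn a b)ᶜ ∩ (openConn a c)ᶜ ∩ (openConn b c)ᶜ) ^ 6 ≤
        (prodBernoulli w).real ((openConn a c)ᶜ ∩ (openConn b c)ᶜ) ^ 2 *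
          (prodBernoulli w).real ((openConn a b)ᶜ ∩ (openConn b c)ᶜ) ^ 3 *
            (prodBernoulli w).real ((openConn a b)ᶜ ∩ (openConn a c)ᶜ) ^ 3 from H _ w a b c rfl
  intro n
  induction n using Nat.strong_induction_on with
  | _ n ih =>
  intro w a b c hn
  -- `a = b`: `Q = 0`
  by_cases hab : a = b
  · subst hab
    have h0 : (prodBernoulli w).real ((openConn a a)ᶜ ∩ (openConn a c)ᶜ ∩ (openConn a c)ᶜ) = 0 := by
      have : ((openConn a a)ᶜ ∩ (openConn a c)ᶜ ∩ (openConn a c)ᶜ : Set (BondConfig V)) = ∅ := by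
        ext ω
        simp only [mem_inter_iff, mem_compl_iff, openConn, mem_setOf_eq, mem_empty_iff_false, iff_false]
        exact fun h => h.1.1 (SimpleGraph.Reachable.refl a)
      rw [this, measureReal_empty]
    rw [h0, zero_pow (by norm_num)]
    positivity
  -- `a` or `b` surely joined to `c`: `Q = 0`
  by_cases hKa : (openGraph {e : Sym2 V | (w e : ℝ) = 1}).Reachable c a
  · rw [real_sep_eq_zero_of_sure w hKa, zero_pow (by norm_num)]
    positivity
  by_cases hKb : (openGraph {e : Sym2 V | (w e : ℝ) = 1}).Reachable c b
  · have hswap : ((openConn a b)ᶜ ∩ (openConn a c)ᶜ ∩ (openConn b c)ᶜ : Set (BondConfig V)) =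
        (openConn b a)ᶜ ∩ (openConn b c)ᶜ ∩ (openConn a c)ᶜ := by
      rw [KNPreFKG.openConn_symm a b]; ext ω; simp only [mem_inter_iff]; tauto
    rw [hswap, real_sep_eq_zero_of_sure w hKb, zero_pow (by norm_num)]
    positivity
  -- a fractional pair leaving the sure component: one-bond step at the port `u`
  by_cases hA : ∃ u x : V, (openGraph {e : Sym2 V | (w e : ℝ) = 1}).Reachable c u ∧
      ¬ (openGraph {e : Sym2 V | (w e : ℝ) = 1}).Reachable c x ∧ (0 : ℝ) < w s(u, x) ∧ (w s(u, x) : ℝ) < 1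
  · obtain ⟨u, x, hu, -, h0, h1⟩ := hA
    have hau : a ≠ u := fun h => hKa (h ▸ hu)
    have hbu : b ≠ u := fun h => hKb (h ▸ hu)
    obtain ⟨eS, eC, eB, eA⟩ := transfer w (a := a) (b := b) (real_openConn_eq_one_of_sure w hu)
    rw [eS, eC, eB, eA]
    refine isoSexticPort_oneBond w x hab hau hbu ?_ ?_
    · exact ih _ (hn ▸ card_fractional_update_lt w h0 h1 0 (Or.inl rfl)) _ a b u rfl
    · exact ih _ (hn ▸ card_fractional_update_lt w h0 h1 1 (Or.inr rfl)) _ a b u rfl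
  -- no fractional pair leaves the sure component
  · exact isoSexticPort_of_closedSure w hKa hKb hA

/-- **The full sextic isolation system `(Q6)` on every finite weighted graph**: with `Q = μ(a|b|c)`, `I_c = μ(c ↮ {a,b})`, `I_b = μ(b ↮ {a,c})`,
`I_a = μ(a ↮ {b,c})`:  `Q⁶ ≤ I_c²I_b³I_a³`, `Q⁶ ≤ I_c³I_b²I_a³` and `Q⁶ ≤ I_c³I_b³I_a²`. [this work] -/
theorem isoSexticSystem_all (w : Sym2 V → unitInterval) (a b c : V) :
    (prodBernoulli w).real ((openConn a b)ᶜ ∩ (openConn a c)ᶜ ∩ (openConn b c)ᶜ) ^ 6 ≤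
        (prodBernoulli w).real ((openConn a c)ᶜ ∩ (openConn b c)ᶜ) ^ 2 *
          (prodBernoulli w).real ((openConn a b)ᶜ ∩ (openConn b c)ᶜ) ^ 3 *
            (prodBernoulli w).real ((openConn a b)ᶜ ∩ (openConn a c)ᶜ) ^ 3 ∧
      (prodBernoulli w).real ((openConn a b)ᶜ ∩ (openConn a c)ᶜ ∩ (openConn b c)ᶜ) ^ 6 ≤
        (prodBernoulli w).real ((openConn a c)ᶜ ∩ (openConn b c)ᶜ) ^ 3 *
          (prodBernoulli w).real ((openConn a b)ᶜ ∩ (openConn b c)ᶜ) ^ 2 *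
            (prodBernoulli w).real ((openConn a b)ᶜ ∩ (openConn a c)ᶜ) ^ 3 ∧
      (prodBernoulli w).real ((openConn a b)ᶜ ∩ (openConn a c)ᶜ ∩ (openConn b c)ᶜ) ^ 6 ≤
        (prodBernoulli w).real ((openConn a c)ᶜ ∩ (openConn b c)ᶜ) ^ 3 *
          (prodBernoulli w).real ((openConn a b)ᶜ ∩ (openConn b c)ᶜ) ^ 3 *
            (prodBernoulli w).real ((openConn a b)ᶜ ∩ (openConn a c)ᶜ) ^ 2 := by
  refine ⟨isoSexticPort_all w a b c, ?_, ?_⟩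
  · -- port `b`: the triple `(a, c; b)`
    have h := isoSexticPort_all w a c b
    have e1 : ((openConn a c)ᶜ ∩ (openConn a b)ᶜ ∩ (openConn c b)ᶜ : Set (BondConfig V)) =
        (openConn a b)ᶜ ∩ (openConn a c)ᶜ ∩ (openConn b c)ᶜ := by
      rw [KNPreFKG.openConn_symm c b]; ext ω; simp only [mem_inter_iff]; tauto
    have e2 : ((openConn a b)ᶜ ∩ (openConn c b)ᶜ : Set (BondConfig V)) = (openConn a b)ᶜ ∩ (openConn b c)ᶜ := by
      rw [KNPreFKG.openConn_symm c b]
    have e3 : ((openConn a c)ᶜ ∩ (openConn c b)ᶜ : Set (BondConfig V)) = (openConn a c)ᶜ ∩ (openConn b c)ᶜ := by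
      rw [KNPreFKG.openConn_symm c b]
    have e4 : ((openConn a c)ᶜ ∩ (openConn a b)ᶜ : Set (BondConfig V)) = (openConn a b)ᶜ ∩ (openConn a c)ᶜ := inter_comm _ _
    rw [e1, e2, e3, e4] at h
    calc _ ≤ _ := h
      _ = _ := by ring
  · -- port `a`: the triple `(b, c; a)`
    have h := isoSexticPort_all w b c a
    have e1 : ((openConn b c)ᶜ ∩ (openConn b a)ᶜ ∩ (openConn c a)ᶜ : Set (BondConfig V)) =
        (openConn a b)ᶜ ∩ (openConn a c)ᶜ ∩ (openConn b c)ᶜ := by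
      rw [KNPreFKG.openConn_symm b a, KNPreFKG.openConn_symm c a]; ext ω; simp only [mem_inter_iff]; tauto
    have e2 : ((openConn b a)ᶜ ∩ (openConn c a)ᶜ : Set (BondConfig V)) = (openConn a b)ᶜ ∩ (openConn a c)ᶜ := by
      rw [KNPreFKG.openConn_symm b a, KNPreFKG.openConn_symm c a]
    have e3 : ((openConn b c)ᶜ ∩ (openConn c a)ᶜ : Set (BondConfig V)) = (openConn a c)ᶜ ∩ (openConn b c)ᶜ := by
      rw [KNPreFKG.openConn_symm c a, inter_comm]
    have e4 : ((openConn b c)ᶜ ∩ (openConn b a)ᶜ : Set (BondConfig V)) = (openConn a b)ᶜ ∩ (openConn b c)ᶜ := by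
      rw [KNPreFKG.openConn_symm b a, inter_comm]
    rw [e1, e2, e3, e4] at h
    calc _ ≤ _ := h
      _ = _ := by ring

/-- **The face inequality `(C½)` at every terminal of every finite weighted graph**, in isolation coordinates:
`2Q·(1 + 2Q − I_a − I_b − I_c) ≤ (I_a + I_b − 2Q)·(1 + 2(I_c − Q))`, i.e. `q·x ≤ (t+u)(s+½)` in the cells (`x = μ(abc)`, `s = μ(ab|c)`,
`t = μ(ac|b)`, `u = μ(bc|a)`, `q = μ(a|b|c)`; port `c`).  From `isoSexticPort_all` and `ThreePointIsoSexticFace.face_half_of_isoSexticPort`. [this work] -/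
theorem faceHalf_all (w : Sym2 V → unitInterval) (a b c : V) :
    2 * (prodBernoulli w).real ((openConn a b)ᶜ ∩ (openConn a c)ᶜ ∩ (openConn b c)ᶜ) *
        (1 + 2 * (prodBernoulli w).real ((openConn a b)ᶜ ∩ (openConn a c)ᶜ ∩ (openConn b c)ᶜ)
          - (prodBernoulli w).real ((openConn a b)ᶜ ∩ (openConn a c)ᶜ) - (prodBernoulli w).real ((openConn a b)ᶜ ∩ (openConn b c)ᶜ)
          - (prodBernoulli w).real ((openConn a c)ᶜ ∩ (openConn b c)ᶜ)) ≤
      ((prodBernoulli w).real ((openConn a b)ᶜ ∩ (openConn a c)ᶜ) + (prodBernoulli w).real ((openConn a b)ᶜ ∩ (openConn b c)ᶜ)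
          - 2 * (prodBernoulli w).real ((openConn a b)ᶜ ∩ (openConn a c)ᶜ ∩ (openConn b c)ᶜ)) *
        (1 + 2 * ((prodBernoulli w).real ((openConn a c)ᶜ ∩ (openConn b c)ᶜ)
          - (prodBernoulli w).real ((openConn a b)ᶜ ∩ (openConn a c)ᶜ ∩ (openConn b c)ᶜ))) := by
  set μ := prodBernoulli w with hμ
  set Q := μ.real ((openConn a b)ᶜ ∩ (openConn a c)ᶜ ∩ (openConn b c)ᶜ) with hQ
  set IA := μ.real ((openConn a b)ᶜ ∩ (openConn a c)ᶜ) with hIA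
  set IB := μ.real ((openConn a b)ᶜ ∩ (openConn b c)ᶜ) with hIB
  set IC := μ.real ((openConn a c)ᶜ ∩ (openConn b c)ᶜ) with hIC
  have h6 := isoSexticPort_all w a b c
  rw [← hμ] at h6
  change Q ^ 6 ≤ IC ^ 2 * IB ^ 3 * IA ^ 3 at h6
  have hQ0 : 0 ≤ Q := measureReal_nonneg
  have hQA : Q ≤ IA := measureReal_mono (fun ω hω => hω.1)
  have hQB : Q ≤ IB := measureReal_mono (fun ω hω => ⟨hω.1.1, hω.2⟩)
  have hQC : Q ≤ IC := measureReal_mono (fun ω hω => ⟨hω.1.2, hω.2⟩)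
  have key := ThreePointIsoSexticFace.face_half_of_isoSexticPort (q := Q) (s := IC - Q) (t := IB - Q) (u := IA - Q) hQ0
    (sub_nonneg.2 hQC) (sub_nonneg.2 hQB) (sub_nonneg.2 hQA)
    (by have e1 : Q + (IA - Q) = IA := by ring
        have e2 : Q + (IB - Q) = IB := by ring
        have e3 : Q + (IC - Q) = IC := by ring
        rw [e1, e2, e3]; calc Q ^ 6 ≤ IC ^ 2 * IB ^ 3 * IA ^ 3 := h6
          _ = IA ^ 3 * IB ^ 3 * IC ^ 2 := by ring)
  nlinarith [key]

end Graph

end Summit.CriticalPhenomena.PercolationContinuityZ3.Theorems.ThreePointIsoSexticUniversal
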